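import Summits.Parity.BatemanHorn.Theorems.SoloInformedTwinBoxBFI
import Summits.Parity.BatemanHorn.Theorems.SoloInformedTwinBoxClassBounds
import Summits.Parity.BatemanHorn.Theorems.SoloInformedTwinUnbalancedSmall

/-!
# The unbalanced twin sum, regime (1b) — VI: the bilinear input on the free boxes

Soloist file (informed mode), file F4c-β3 of the kernel project for (F′).  We verify the
hypotheses of the box bound `sum_abs_freeSum_le` (F4b: Bombieri–Friedlander–Iwaniec Theorem 0(b)
for the Möbius log-power pieces) on every FREE box of the classification — a box `(i, l)` with
`K₀ < boxHigh_i`, `y/(2z) < N`, `(1+Δ)² MN ≤ hi` and `V ≤ MN`, `V = X^{1/2} + z² (log X)^{2n₁}` —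
from global hypotheses on the parameters: `hi ≤ X`, `ΔK₀ ≥ 2`, `X^{4ε'} ≤ K₀`, `2z X^{ε'} ≤ y`,
`2z ≤ Δ y`, and `X` large.  The output is exactly the input `hF` of `sum_classF_le`.
-/

namespace Summit.Parity.BatemanHorn.Theorems

open Finset Real
open scoped ArithmeticFunction.Moebius
open Literature.NumberTheory.Sieve Literature.NumberTheory.Sieve.BFI

/-- `N ≤ (MN)^{1-ε'}` from `N^{ε'} ≤ M^{1-ε'}` (`M ≥ 0`, `N > 0`). -/
theorem le_mul_rpow_of_rpow_le {M N ε' : ℝ} (hM : 0 ≤ M) (hN : 0 < N)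
    (h : N ^ ε' ≤ M ^ (1 - ε')) : N ≤ (M * N) ^ (1 - ε') := by
  rw [Real.mul_rpow hM hN.le]
  have e : N = N ^ ε' * N ^ (1 - ε') := by
    rw [← Real.rpow_add hN]; norm_num
  calc N = N ^ ε' * N ^ (1 - ε') := e
    _ ≤ M ^ (1 - ε') * N ^ (1 - ε') := mul_le_mul_of_nonneg_right h (Real.rpow_nonneg hN.le _)

/-- `X^{2ε'} ≤ M^{1-ε'}` when `X^{3ε'} ≤ M`, `X ≥ 1`, `0 < ε' ≤ 1/8`. -/
theorem rpow_two_mul_le_rpow_of_le {X M ε' : ℝ} (hX : 1 ≤ X) (hε' : 0 < ε') (hε'1 : ε' ≤ 1 / 8)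
    (hM : X ^ (3 * ε') ≤ M) : X ^ (2 * ε') ≤ M ^ (1 - ε') := by
  have hX0 : 0 ≤ X := by linarith
  have h1 : 0 ≤ ε' * (1 - 3 * ε') := mul_nonneg hε'.le (by linarith)
  have h2 : 2 * ε' ≤ 3 * ε' * (1 - ε') := by
    linarith [h1, show ε' * (1 - 3 * ε') = 3 * ε' * (1 - ε') - 2 * ε' by ring]
  calc X ^ (2 * ε') ≤ X ^ (3 * ε' * (1 - ε')) := Real.rpow_le_rpow_of_exponent_le hX h2
    _ = (X ^ (3 * ε')) ^ (1 - ε') := by rw [Real.rpow_mul hX0]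
    _ ≤ M ^ (1 - ε') := Real.rpow_le_rpow (Real.rpow_nonneg hX0 _) hM (by linarith)

/-- **The bilinear input on the free boxes.**  For the family `r₀ ∈ {1, 2}` (`a` prime to the
moduli prime to `r₀`), `0 < ε' ≤ 1/8` and `A' > 0` there are `n₁ : ℕ`, `C_F ≥ 0`, `X₂` such
that for `X ≥ X₂`, `0 < Δ ≤ 1`, `0 < hi ≤ X`, `ΔK₀ ≥ 2`, `X^{4ε'} ≤ K₀`, `1 ≤ z`,
`2z X^{ε'} ≤ y`, `2z ≤ Δy`, every free box (with `V = X^{1/2} + z² (log X)^{2n₁}`) satisfies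
`∑_{q ≤ z, (q,r₀)=1} |freeSum(q;i,l)| ≤ C_F Δ MN (log hi)^j (1+log z)^8 / log(MN)^{A'}`. -/
theorem free_box_input (j : ℕ) {r₀ : ℕ} {a : ℤ} (hr₀ : r₀ = 1 ∨ r₀ = 2)
    (ha : ∀ q : ℕ, q.Coprime r₀ → IsCoprime (q : ℤ) a) {ε' A' : ℝ} (hε' : 0 < ε')
    (hε'1 : ε' ≤ 1 / 8) (hA' : 0 < A') :
    ∃ n₁ : ℕ, ∃ CF X₂ : ℝ, 0 ≤ CF ∧ ∀ X : ℝ, X₂ ≤ X → ∀ (hi y z K₀ K : ℕ) (Δ : ℝ),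
      0 < Δ → Δ ≤ 1 → 0 < hi → (hi : ℝ) ≤ X → 2 ≤ Δ * K₀ → X ^ (4 * ε') ≤ K₀ → 1 ≤ z →
      2 * z * X ^ ε' ≤ (y : ℝ) → 2 * (z : ℝ) ≤ Δ * y →
      ∀ i l : ℕ, (K₀ : ℝ) < boxHigh (K : ℝ) Δ i → (y : ℝ) / (2 * z) < boxLow (hi : ℝ) Δ l →
        (1 + Δ) ^ 2 * (boxLow (K : ℝ) Δ i * boxLow (hi : ℝ) Δ l) ≤ hi →
        X ^ (1 / 2 : ℝ) + (z : ℝ) ^ 2 * Real.log X ^ (2 * n₁) ≤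
          boxLow (K : ℝ) Δ i * boxLow (hi : ℝ) Δ l →
        ∑ q ∈ (Icc 1 z).filter (fun q : ℕ => q.Coprime r₀), |freeSum j r₀ hi a K₀ K Δ q i l| ≤
          CF * Δ * (boxLow (K : ℝ) Δ i * boxLow (hi : ℝ) Δ l) * Real.log hi ^ j *
            (1 + Real.log z) ^ 8 / Real.log (boxLow (K : ℝ) Δ i * boxLow (hi : ℝ) Δ l) ^ A' := by
  obtain ⟨B₁, C, X₁, hB₁, hC, hmain⟩ := sum_abs_freeSum_le j hr₀ ha hε' hA'
  -- `X^{ε'} ≥ 2` eventually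
  have hev : ∀ᶠ X : ℝ in Filter.atTop, 2 ≤ X ^ ε' :=
    (tendsto_rpow_atTop hε').eventually_ge_atTop 2
  obtain ⟨X₃, hX₃⟩ := Filter.eventually_atTop.1 hev
  refine ⟨⌈B₁⌉₊, C, max (max X₃ 9) ((max X₁ 0) ^ 2), hC, ?_⟩
  intro X hX hi y z K₀ K Δ hΔ hΔ1 hhi hhiX hK₀ hK₀X hz hzy hzΔ i l hKi hNy hprod hV
  set n₁ : ℕ := ⌈B₁⌉₊ with hn₁
  set M : ℝ := boxLow (K : ℝ) Δ i with hMdef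
  set N : ℝ := boxLow (hi : ℝ) Δ l with hNdef
  have hX9 : (9 : ℝ) ≤ X := le_trans (le_trans (le_max_right _ _) (le_max_left _ _)) hX
  have hX3' : X₃ ≤ X := le_trans (le_trans (le_max_left _ _) (le_max_left _ _)) hX
  have hX1sq : (max X₁ 0) ^ 2 ≤ X := le_trans (le_max_right _ _) hX
  have hX1 : (1 : ℝ) ≤ X := by linarith
  have hX0 : (0 : ℝ) ≤ X := by linarith
  have hL2 : 2 ≤ Real.log X := two_le_log_of_nine_le hX9
  have hL1 : 1 ≤ Real.log X := by linarith
  have h2ε : (2 : ℝ) ≤ X ^ ε' := hX₃ X hX3'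
  have h1Δ : (0 : ℝ) < 1 + Δ := by linarith
  have hM0 : 0 ≤ M := by rw [hMdef]; unfold boxLow; positivity
  have hNpos : 0 < N := boxLow_pos (by exact_mod_cast hhi) (by linarith) l
  have hz' : (1 : ℝ) ≤ z := by exact_mod_cast hz
  have hz0 : (0 : ℝ) < z := by linarith
  -- `X^{1/2} ≤ V ≤ MN ≤ hi ≤ X`
  have hsqrt : X ^ (1 / 2 : ℝ) ≤ M * N :=
    le_trans (le_add_of_nonneg_right (by positivity)) hV
  have hMNhi : M * N ≤ hi := by
    have h1 : (1 : ℝ) ≤ (1 + Δ) ^ 2 := by nlinarith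
    have := mul_le_mul_of_nonneg_right h1 (mul_nonneg hM0 hNpos.le)
    linarith
  have hMNX : M * N ≤ X := hMNhi.trans hhiX
  have h3sqrt : (3 : ℝ) ≤ X ^ (1 / 2 : ℝ) := by
    refine le_rpow_half_of_sq_le (by norm_num) ?_
    norm_num; linarith
  have hMN3 : 3 ≤ M * N := h3sqrt.trans hsqrt
  have hMNpos : 0 < M * N := by linarith
  have hlogMN1 : 1 ≤ Real.log (M * N) := by
    rw [Real.le_log_iff_exp_le hMNpos]
    exact le_trans Real.exp_one_lt_three.le hMN3
  have hlogMN0 : 0 < Real.log (M * N) := by linarith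
  have hlogMNL : Real.log (M * N) ≤ Real.log X := Real.log_le_log hMNpos hMNX
  -- (a) `X₁ ≤ MN`
  have ha' : X₁ ≤ M * N := by
    have h1 : max X₁ 0 ≤ X ^ (1 / 2 : ℝ) := le_rpow_half_of_sq_le (le_max_right _ _) hX1sq
    exact (le_max_left _ _).trans (h1.trans hsqrt)
  -- (b) `(MN)^{ε'} ≤ N`
  have hb' : (M * N) ^ ε' ≤ N := by
    have h1 : (M * N) ^ ε' ≤ X ^ ε' := Real.rpow_le_rpow hMNpos.le hMNX hε'.le
    have h2 : X ^ ε' ≤ (y : ℝ) / (2 * z) := by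
      rw [le_div_iff₀ (by positivity)]; linarith
    exact h1.trans (h2.trans hNy.le)
  -- (c) `N ≤ (MN)^{1-ε'}`
  have hc' : N ≤ (M * N) ^ (1 - ε') := by
    refine le_mul_rpow_of_rpow_le hM0 hNpos ?_
    have hNX : N ≤ X := by
      have : N ≤ hi := (boxLow_le_boxHigh (Nat.cast_nonneg hi) hΔ.le l).trans
        (boxHigh_le_self (Nat.cast_nonneg hi) hΔ.le l)
      exact this.trans hhiX
    have h3M : X ^ (3 * ε') ≤ M := by
      -- `M > K₀/(1+Δ) ≥ K₀/2 ≥ X^{4ε'}/2 ≥ X^{3ε'}`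
      have hKM : (K₀ : ℝ) < (1 + Δ) * M := by
        rw [hMdef, ← boxHigh_eq_mul_boxLow (by linarith)]; exact hKi
      have h4 : X ^ (4 * ε') = X ^ (3 * ε') * X ^ ε' := by
        rw [← Real.rpow_add (by linarith)]; ring_nf
      have h5 : 2 * X ^ (3 * ε') ≤ X ^ (4 * ε') := by
        rw [h4]
        have := mul_le_mul_of_nonneg_left h2ε (Real.rpow_nonneg hX0 (3 * ε'))
        linarith
      have h6 : (1 + Δ) * M ≤ 2 * M := by nlinarith [mul_nonneg (sub_nonneg.2 hΔ1) hM0]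
      linarith
    calc N ^ ε' ≤ X ^ ε' := Real.rpow_le_rpow hNpos.le hNX hε'.le
      _ ≤ X ^ (2 * ε') := Real.rpow_le_rpow_of_exponent_le hX1 (by linarith)
      _ ≤ M ^ (1 - ε') := rpow_two_mul_le_rpow_of_le hX1 hε' hε'1 h3M
  -- (d) the level: `z ≤ (MN)^{1/2} / log(MN)^{B₁}`
  have hd' : (z : ℝ) ≤ (M * N) ^ (1 / 2 : ℝ) / Real.log (M * N) ^ B₁ := by
    have hpowpos : 0 < Real.log (M * N) ^ B₁ := Real.rpow_pos_of_pos hlogMN0 _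
    rw [le_div_iff₀ hpowpos]
    have h1 : Real.log (M * N) ^ B₁ ≤ Real.log X ^ (n₁ : ℝ) :=
      calc Real.log (M * N) ^ B₁ ≤ Real.log X ^ B₁ :=
            Real.rpow_le_rpow hlogMN0.le hlogMNL hB₁.le
        _ ≤ Real.log X ^ (n₁ : ℝ) := Real.rpow_le_rpow_of_exponent_le hL1 (Nat.le_ceil B₁)
    rw [Real.rpow_natCast] at h1
    have h2 : (z : ℝ) * Real.log X ^ n₁ ≤ (M * N) ^ (1 / 2 : ℝ) := by
      refine le_rpow_half_of_sq_le (by positivity) ?_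
      have e2 : ((z : ℝ) * Real.log X ^ n₁) ^ 2 = (z : ℝ) ^ 2 * Real.log X ^ (2 * n₁) := by
        rw [mul_pow, ← pow_mul']
      rw [e2]
      exact le_trans (le_add_of_nonneg_left (Real.rpow_nonneg hX0 _)) hV
    calc (z : ℝ) * Real.log (M * N) ^ B₁ ≤ (z : ℝ) * Real.log X ^ n₁ :=
          mul_le_mul_of_nonneg_left h1 hz0.le
      _ ≤ (M * N) ^ (1 / 2 : ℝ) := h2
  -- (e), (f) the box side lengths
  have he' : 1 ≤ Δ * M := one_le_mul_boxLow_of_lt hΔ hΔ1 hK₀ hKi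
  have hf' : 1 ≤ Δ * N := by
    have h1 : Δ * ((y : ℝ) / (2 * z)) ≤ Δ * N := mul_le_mul_of_nonneg_left hNy.le hΔ.le
    have h2 : 1 ≤ Δ * ((y : ℝ) / (2 * z)) := by
      rw [mul_div_assoc', le_div_iff₀ (by positivity)]; linarith
    exact h2.trans h1
  exact hmain hi K₀ K z i l Δ hΔ hΔ1 ha' hb' hc' hd' he' hf'

end Summit.Parity.BatemanHorn.Theorems
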